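import Mathlib
import HarnessLib
import Summits.NavierStokesRegularity.NavierStokesRegularity.Theorems.SymmetryModuliCountForcedSymmetryStubBlowDownDriver

/-!
# Route SymmetryModuliCount — crux `ForcedSymmetry` (stmt-NavierStokesRegularity-4052), line
# `blow-down-census`, stub `stub_blowDownDriver` (`stPull` form, singular limit IN the class)

The BLOW-DOWN DRIVER in the currency of the lead's skeleton `typeIAncientLiouville_of_line`:
given the uniform cubic bound `hcubic` and the pressure package `hPress` of the ledger class
`A_C ∩ {ledger K}` (hypotheses), an element `v ∈ A_C` (`IsTypeIAncientMild C v`) with ledger `K`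
and a point `(t₀, x₀)`, `t₀ < 0`, with `v(t₀, x₀) ≠ 0`, there are a centre `(t₁, x₁)`, `t₁ ≤ 0`,
scales `c_k > 0`, `c_k → ∞`, and a field `W ∈ A_C` such that the blow-downs
`c_k • stPull (c_k²) c_k t₁ x₁ v = c_k v(t₁ + c_k² ·, x₁ + c_k ·)` converge to `W` at every point
of `s < 0` AND the space–time origin is a backward singular point of `W` itself
(`‖W‖_{L∞(Q(0,r))} = ∞` for every `r > 0`).

This is a corollary of the tree's general driver
`Theorems.ForcedSymmetry.BlowDownCensus.stub_blowDownDriver`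
(`Theorems/SymmetryModuliCountForcedSymmetryStubBlowDownDriver.lean`: Albritton–Barker's Lemma 2.2
and Prop. 2.3 along the blow-down sequence give an `L³_loc` limit `U` singular at the origin, the
`C¹_loc` compactness of `A_C` a pointwise limit `W ∈ A_C`, and `U = W` a.e. on `Q(0, ½)`), by the
transfer of backward singularities along an a.e. equality on ONE parabolic ball
(`isBackwardSingularPoint_zero_of_ae_eq`): for `r ≤ ½` restrict the a.e. equality to
`Q(0, r) ⊆ Q(0, ½)` (`eLpNorm_congr_ae`), for `r > ½` use the monotonicity of the `L^∞` norm in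
the measure (`Q(0, ½) ⊆ Q(0, r)`).

## References

* D. Albritton, T. Barker, J. Math. Fluid Mech. 21 (2019) = arXiv:1811.00502, Lemma 2.2,
  Prop. 2.3, §3. [AlbrittonBarker2019]
-/

noncomputable section

-- the summit and its single problem share the name (D-0017 nested layout)
set_option linter.dupNamespace false

open MeasureTheory Set Metric Filter Function TopologicalSpace
open scoped ENNReal NNReal Topology

namespace Summit.NavierStokesRegularity.NavierStokesRegularity.Theorems.SymmetryModuliCountForcedSymmetry

open Literature.Analysis.FluidPDE
open Summit.NavierStokesRegularity.NavierStokesRegularity.Theorems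

/-- **Transfer of a backward singularity at the origin along an a.e. equality on one parabolic
ball.** If `U` is backward-singular at `0` (`‖U‖_{L∞(Q(0,r))} = ∞` for all `r > 0`) and `U = W`
a.e. on `Q(0, R)` for some `R > 0`, then `W` is backward-singular at `0`: for `r ≤ R` the a.e.
equality restricts to `Q(0, r) ⊆ Q(0, R)`, for `r > R` the `L^∞` norm on `Q(0, r) ⊇ Q(0, R)`
dominates the one on `Q(0, R)`. [folklore] -/
theorem isBackwardSingularPoint_zero_of_ae_eq
    {U W : ℝ → EuclideanSpace ℝ (Fin 3) → EuclideanSpace ℝ (Fin 3)} {R : ℝ} (hR : 0 < R)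
    (hU : IsBackwardSingularPoint U 0)
    (hae : uncurry U =ᵐ[volume.restrict (parabolicCylinder R (0 : ℝ × EuclideanSpace ℝ (Fin 3)))]
      uncurry W) :
    IsBackwardSingularPoint W 0 := by
  have hsmall : ∀ r, 0 < r → r ≤ R → eLpNorm (uncurry W) ∞
      (volume.restrict (parabolicCylinder r (0 : ℝ × EuclideanSpace ℝ (Fin 3)))) = ∞ := by
    intro r hr hrR
    have h1 : uncurry U =ᵐ[volume.restrict (parabolicCylinder r (0 : ℝ × EuclideanSpace ℝ (Fin 3)))]
        uncurry W :=
      ae_restrict_of_ae_restrict_of_subset (parabolicCylinder_mono hr.le hrR _) hae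
    exact (eLpNorm_congr_ae h1).symm.trans (hU r hr)
  intro r hr
  rcases le_or_gt r R with h | h
  · exact hsmall r hr h
  · exact eq_top_iff.2 ((hsmall R hR le_rfl).symm.trans_le
      (eLpNorm_mono_measure (uncurry W)
        (Measure.restrict_mono (parabolicCylinder_mono hR.le h.le _) le_rfl)))

/-- **Stub 3 of line `blow-down-census` — the BLOW-DOWN DRIVER with a singular limit INSIDE the
class** (the lead's registered signature, `stPull` form). Given the uniform cubic bound `hcubic`
and the pressure package `hPress` of the ledger class with constants `C, K, D₀`, an element
`v ∈ A_C` with ledger `K` and a point `(t₀, x₀)`, `t₀ < 0`, with `v(t₀, x₀) ≠ 0`: there are a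
centre `(t₁, x₁)`, `t₁ ≤ 0`, scales `c_k > 0`, `c_k → ∞`, and `W ∈ A_C` such that the blow-downs
`c_k v(t₁ + c_k² s, x₁ + c_k y)` converge to `W(s, y)` at every point of `s < 0` and the origin is
a backward singular point of `W` — the general driver
`Theorems.ForcedSymmetry.BlowDownCensus.stub_blowDownDriver` (A–B Lemma 2.2 / Prop. 2.3 limit `U`,
singular at `0`, a.e. equal on `Q(0, ½)` to the `C¹_loc` limit `W ∈ A_C`) followed by the transfer
`isBackwardSingularPoint_zero_of_ae_eq`. [cite: AlbrittonBarker2019, Lemma 2.2, Prop. 2.3 and §3] -/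
theorem stub_blowDownDriver :
    ∀ (C K D₀ : ℝ),
      (∀ w : ℝ → EuclideanSpace ℝ (Fin 3) → EuclideanSpace ℝ (Fin 3), IsTypeIAncientMild C w →
        (∀ t < 0, ∀ (x₀ : EuclideanSpace ℝ (Fin 3)) (R : ℝ), 0 < R →
          ∫ x in ball x₀ R, ‖w t x‖ ^ 2 ≤ K * R) →
        ∫⁻ z in parabolicCylinder 1 (0 : ℝ × EuclideanSpace ℝ (Fin 3)), ‖w z.1 z.2‖ₑ ^ (3 : ℕ) ≤
          ENNReal.ofReal (2 * C * K)) →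
      (∀ w : ℝ → EuclideanSpace ℝ (Fin 3) → EuclideanSpace ℝ (Fin 3), IsTypeIAncientMild C w →
        (∀ t < 0, ∀ (x₀ : EuclideanSpace ℝ (Fin 3)) (R : ℝ), 0 < R →
          ∫ x in ball x₀ R, ‖w t x‖ ^ 2 ≤ K * R) →
        ∀ T ∈ Ioc (0 : ℝ) 1, ∃ q : ℝ → EuclideanSpace ℝ (Fin 3) → ℝ,
          IsSuitableWeakSolutionInBall 1 0 (fun s y => w (s - T) y) q ∧
          ∫⁻ z in parabolicCylinder 1 (0 : ℝ × EuclideanSpace ℝ (Fin 3)), ‖q z.1 z.2‖ₑ ^ (3 / 2 : ℝ) ≤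
            ENNReal.ofReal D₀) →
      ∀ v : ℝ → EuclideanSpace ℝ (Fin 3) → EuclideanSpace ℝ (Fin 3), IsTypeIAncientMild C v →
        (∀ t < 0, ∀ (x₀ : EuclideanSpace ℝ (Fin 3)) (R : ℝ), 0 < R →
          ∫ x in ball x₀ R, ‖v t x‖ ^ 2 ≤ K * R) →
        ∀ t₀ < (0 : ℝ), ∀ x₀ : EuclideanSpace ℝ (Fin 3), v t₀ x₀ ≠ 0 →
        ∃ (t₁ : ℝ) (x₁ : EuclideanSpace ℝ (Fin 3)) (c : ℕ → ℝ)
          (W : ℝ → EuclideanSpace ℝ (Fin 3) → EuclideanSpace ℝ (Fin 3)),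
          t₁ ≤ 0 ∧ (∀ k, 0 < c k) ∧ Tendsto c atTop atTop ∧ IsTypeIAncientMild C W ∧
          (∀ s < (0 : ℝ), ∀ y : EuclideanSpace ℝ (Fin 3),
            Tendsto (fun k => (c k • stPull (c k ^ 2) (c k) t₁ x₁ v) s y) atTop (𝓝 (W s y))) ∧
          IsBackwardSingularPoint W 0 := by
  intro C K D₀ hcubic hPress v hv hKv t₀ ht₀ x₀ hne
  obtain ⟨t₁, x₁, c, U, W, ht₁, hcpos, hctop, hW, hpt, -, hsingU, hae⟩ :=
    Summit.NavierStokesRegularity.NavierStokesRegularity.Theorems.ForcedSymmetry.BlowDownCensus.stub_blowDownDriver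
      C K D₀ hcubic hPress v hv hKv t₀ x₀ ht₀ hne
  refine ⟨t₁, x₁, c, W, ht₁.le, hcpos, hctop, hW, fun s hs y => ?_,
    isBackwardSingularPoint_zero_of_ae_eq one_half_pos hsingU hae⟩
  -- `(c_k • stPull (c_k²) c_k t₁ x₁ v) s y = c_k • v (t₁ + c_k² s) (x₁ + c_k y)` (`smul_stPull_apply`)
  simpa only [smul_stPull_apply] using hpt s hs y

/-- **Stub 3 of line `blow-down-census`, `stPull` form — registered name.** The same statement as
`stub_blowDownDriver` (the lead's skeleton signature: centre `t₁ ≤ 0`, blow-downs written as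
`c_k • stPull (c_k²) c_k t₁ x₁ v`, the singular vertex carried by the class limit `W` itself), under
the name registered for this sub-goal on the crux item next to the general driver
`Theorems.ForcedSymmetry.BlowDownCensus.stub_blowDownDriver`.
[cite: AlbrittonBarker2019, Lemma 2.2, Prop. 2.3 and §3] -/
theorem stub_blowDownDriver_stPull :
    ∀ (C K D₀ : ℝ),
      (∀ w : ℝ → EuclideanSpace ℝ (Fin 3) → EuclideanSpace ℝ (Fin 3), IsTypeIAncientMild C w →
        (∀ t < 0, ∀ (x₀ : EuclideanSpace ℝ (Fin 3)) (R : ℝ), 0 < R →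
          ∫ x in ball x₀ R, ‖w t x‖ ^ 2 ≤ K * R) →
        ∫⁻ z in parabolicCylinder 1 (0 : ℝ × EuclideanSpace ℝ (Fin 3)), ‖w z.1 z.2‖ₑ ^ (3 : ℕ) ≤
          ENNReal.ofReal (2 * C * K)) →
      (∀ w : ℝ → EuclideanSpace ℝ (Fin 3) → EuclideanSpace ℝ (Fin 3), IsTypeIAncientMild C w →
        (∀ t < 0, ∀ (x₀ : EuclideanSpace ℝ (Fin 3)) (R : ℝ), 0 < R →
          ∫ x in ball x₀ R, ‖w t x‖ ^ 2 ≤ K * R) →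
        ∀ T ∈ Ioc (0 : ℝ) 1, ∃ q : ℝ → EuclideanSpace ℝ (Fin 3) → ℝ,
          IsSuitableWeakSolutionInBall 1 0 (fun s y => w (s - T) y) q ∧
          ∫⁻ z in parabolicCylinder 1 (0 : ℝ × EuclideanSpace ℝ (Fin 3)), ‖q z.1 z.2‖ₑ ^ (3 / 2 : ℝ) ≤
            ENNReal.ofReal D₀) →
      ∀ v : ℝ → EuclideanSpace ℝ (Fin 3) → EuclideanSpace ℝ (Fin 3), IsTypeIAncientMild C v →
        (∀ t < 0, ∀ (x₀ : EuclideanSpace ℝ (Fin 3)) (R : ℝ), 0 < R →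
          ∫ x in ball x₀ R, ‖v t x‖ ^ 2 ≤ K * R) →
        ∀ t₀ < (0 : ℝ), ∀ x₀ : EuclideanSpace ℝ (Fin 3), v t₀ x₀ ≠ 0 →
        ∃ (t₁ : ℝ) (x₁ : EuclideanSpace ℝ (Fin 3)) (c : ℕ → ℝ)
          (W : ℝ → EuclideanSpace ℝ (Fin 3) → EuclideanSpace ℝ (Fin 3)),
          t₁ ≤ 0 ∧ (∀ k, 0 < c k) ∧ Tendsto c atTop atTop ∧ IsTypeIAncientMild C W ∧
          (∀ s < (0 : ℝ), ∀ y : EuclideanSpace ℝ (Fin 3),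
            Tendsto (fun k => (c k • stPull (c k ^ 2) (c k) t₁ x₁ v) s y) atTop (𝓝 (W s y))) ∧
          IsBackwardSingularPoint W 0 :=
  stub_blowDownDriver

end Summit.NavierStokesRegularity.NavierStokesRegularity.Theorems.SymmetryModuliCountForcedSymmetry

end
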